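import Summits.QuantumFields.BalabanUV.Beta.GAN24.DerivativeRateTransferSqueeze

/-!
# `BalabanUV.Beta.GAN24.DerivativeRateTransferLoewnerGramMass` — binder row G-an2-4 ∕ (CONV-C), route R6 «VALUES, NOT DERIVATIVES», PART 95:
# THE `G`-MASS LETTER OF THE TOWER END IS ENERGY BOOKKEEPING — `hN` FROM COERCIVITY ON `ker Q`, ONE REFERENCE FIELD PER SOURCE, AND THE SIZE OF `𝒮`
# (unit b2b-balaban-gan24-p3, gen 48; v1)

NOT IN PRINT; OUR PROOF (for the ROUTE; [folklore] finite-dimensional linear algebra — two parallelogram inequalities, PART 18's `dotProduct_effForm_eq_energy` ∕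
`mulVec_minOp` ∕ `abs_apply_le_of_diag_le`, PART 20's `gram_minOp_apply` BY NAME).  HONEST FRAMING (cell contract, verbatim): «discharging `BetaPertH` makes
Bałaban's UV stability UNCONDITIONAL — a real constructive-QFT result; it is NOT the continuum limit and NOT the Clay problem.»  HONEST DEPENDENCY (verbatim):
«continuum YM on T⁴ ⇐ BetaPertH ∧ nine spine estimates (0/9 proved); BetaPertH ⇐ (D1) ∧ (D4) ∧ CAP+tail; G-an2-4 gates asym, D1 and NE2/3/4.»

WHY THIS FILE.  PART 20's tower END under the additive Gram slack (`effForm_entry_step_rate_of_stabGram_of_cons`) and its scheduled form PART 88 carry, besides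
`hB` (discharged from (CONS) alone by the sibling PART 94 `…LoewnerGramBounded`), the letter `hN : |(ℋ_jᵀ G_j ℋ_j)_{ab}| ≤ N` (PART 88: `≤ N₀Λ^j`) — the
`G`-MASS OF THE UNIT-SOURCE MINIMISER COLUMNS — booked since PART 20 as «an (H2)-class regularity datum ([CMP 99] Thm 3.1 (3.42)–(3.47) is the printed
neighbour)».  For a BOUNDED carrier (`G ≤ g·1`, which is the case of record: `G = w_c·d′·QfᵀQf`, `G = QᵀD_τQ` with a bounded diagonal weight) IT IS NOT: the
minimiser `u = ℋe_a` is `r_a + z` with `r_a` ANY admissible reference field (`Q r_a = e_a`) and `z ∈ ker Q`, coercivity of `H` on `ker Q`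
(`γ|z|² ≤ ⟨z,Hz⟩` — PART 93 `coercive_lattice` on the block lattice, `γ = (L^d)⁻¹w_f∕(4(d(L−1))²)`) and two parallelogram inequalities give
`|u|² ≤ 4(𝒮_{aa} + ⟨r_a,Hr_a⟩)∕γ + 2|r_a|²`, hence **`|(ℋᵀGℋ)_{ab}| ≤ g·(4(B + E)∕γ + 2ρ)`** with `E, ρ` the energy and the mass of the reference fields and
`B` the diagonal size of `𝒮` (itself `≤ B₀ + cst∕(1−θ)` from (CONS), PART 94).  So `N` is ENERGY ∕ POINCARÉ BOOKKEEPING; what is level-dependent in it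
(PART 88's growth `Λ`) is a LATTICE COUNT (`g_j, γ_j, E_j, ρ_j` — explicit for block means), not a regularity estimate.  After PART 94 + this file the
sup-road END (PART 88) has exactly TWO Bałaban-class inputs left: the mismatch schedule `τ_j ≤ M₀θ_m^j` [R9°] and (CONS) [R8°] (plus `hrate`); the
RMS road (PART 90 ∕ 91) keeps its sharper, volume-free (H2)-style reduction — this file's bound is the cruder (H2)-free one.

WHAT THIS FILE PROVES (0 sorry, 0 `def`, nothing cited; an1's letters over `ℝ`, fine forms only PSD, bordered matrices nonsingular):
* §1 `form_sub_le_two_mul_add` (`⟨u−r,H(u−r)⟩ ≤ 2⟨u,Hu⟩ + 2⟨r,Hr⟩` for PSD `H`), `dotProduct_self_add_le_two_mul`;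
  **`dotProduct_self_minOp_col_le_of_coercive`**: `γ|z|² ≤ ⟨z,Hz⟩` on `ker Q`, `Q r = e_a` ⟹ `|ℋe_a|² ≤ 4(𝒮_{aa} + ⟨r,Hr⟩)∕γ + 2|r|²`.
* §2 **`gram_minOp_diag_le_of_coercive`** ∕ **`abs_gram_minOp_le_of_coercive`**: `G` PSD with `⟨v,Gv⟩ ≤ g|v|²`, reference fields `r_a` (`Q r_a = e_a`,
  `⟨r_a,Hr_a⟩ ≤ E`, `|r_a|² ≤ ρ`), `𝒮_{aa} ≤ B` ⟹ `|(ℋᵀGℋ)_{ab}| ≤ g·(4(B + E)∕γ + 2ρ)` — THE PRODUCED `hN`.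
* §3 along the tower: `abs_gram_minOp_schedule_of_coercive` (level letters `g_j, γ_j, E_j, ρ_j, B` and ANY majorant `n j` of `g_j(4(B+E_j)∕γ_j + 2ρ_j)` —
  e.g. `N₀Λ^j` for PART 88 — give `|(ℋ_jᵀG_jℋ_j)_{ab}| ≤ n j`), and PART 20's END with `hN` DISCHARGED and `hB` in diagonal form:
  **`effForm_entry_step_rate_of_stabGram_of_cons_of_coercive`** (constant `cst + 2cε·B + 2cδ·g(4(B+E)∕γ + 2ρ)`).
WHAT IT DOES NOT DO: produce (CONS), the (STAB) schedules or the mismatch letter; count `Λ` on Bałaban's tower (the consumer's instantiation of `g_j, γ_j, E_j, ρ_j`);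
touch (H2) proper (pointwise ∕ decay regularity of minimisers WITH background — not needed for `N`, still needed by PART 91's volume-free road).  SUPPLIER work on
route C-R6° (rank 2, REDUCTION); no consumer of record; NEVER «G-an2-4 closed»; NOT (CONV-C), NOT D1, NOT `BetaPertH`, NOT continuum, NOT Clay.  Records:
`HOME/b2b-balaban-gan24-p3/WOODBURY-FIBRE.md` v14.8, `HOME/b2b-balaban-gan24-p3/gen48/README.md`.
-/

noncomputable section

open Set Matrix Finset

namespace Summit.QuantumFields.BalabanUV.Beta.GAN24.DerivativeRateTransferLoewnerGramMass

open Literature.MathematicalPhysics.QuantumFieldTheory.Balaban1983to89.Beta.Composition (kkt)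
open Literature.MathematicalPhysics.QuantumFieldTheory.Balaban1983to89.Beta.CompositionSingular (effForm minOp)
open Summit.QuantumFields.BalabanUV.Beta.GAN24.DerivativeRateTransferLoewnerKKT (abs_apply_le_of_diag_le transpose_eq_of_posSemidef
  dotProduct_effForm_eq_energy mulVec_minOp single_dotProduct_mulVec_single)
open Summit.QuantumFields.BalabanUV.Beta.GAN24.DerivativeRateTransferLoewnerGram (gram_minOp_apply effForm_entry_step_rate_of_stabGram_of_cons)
open Summit.QuantumFields.BalabanUV.Beta.GAN24.DerivativeRateTransferSqueeze (posSemidef_effForm)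

/-! ## §1 The `ℓ²` mass of a minimiser column from coercivity on `ker Q` and one reference field -/

section OneLevel

variable {c ν : Type*} [Fintype c] [Fintype ν] [DecidableEq c] [DecidableEq ν]
variable {H : Matrix ν ν ℝ} {Q : Matrix c ν ℝ} {G : Matrix ν ν ℝ}

omit [Fintype c] [DecidableEq c] [DecidableEq ν] in
/-- **PARALLELOGRAM BOUND FOR A PSD FORM**: `⟨u−r, H(u−r)⟩ ≤ 2⟨u,Hu⟩ + 2⟨r,Hr⟩` (add the non-negative `⟨u+r,H(u+r)⟩`; no symmetry needed). [folklore] -/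
theorem form_sub_le_two_mul_add (hH : H.PosSemidef) (u r : ν → ℝ) :
    (u - r) ⬝ᵥ (H *ᵥ (u - r)) ≤ 2 * (u ⬝ᵥ (H *ᵥ u)) + 2 * (r ⬝ᵥ (H *ᵥ r)) := by
  have h0 := hH.dotProduct_mulVec_nonneg (u + r)
  simp only [star_trivial, mulVec_add, dotProduct_add, add_dotProduct] at h0
  simp only [mulVec_sub, dotProduct_sub, sub_dotProduct]
  linarith

omit [Fintype c] [DecidableEq c] [DecidableEq ν] in
/-- **PARALLELOGRAM BOUND FOR THE MASS**: `|z + r|² ≤ 2|z|² + 2|r|²`. [folklore] -/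
theorem dotProduct_self_add_le_two_mul (z r : ν → ℝ) : (z + r) ⬝ᵥ (z + r) ≤ 2 * (z ⬝ᵥ z) + 2 * (r ⬝ᵥ r) := by
  have h0 : 0 ≤ (z - r) ⬝ᵥ (z - r) := by rw [dotProduct]; exact Finset.sum_nonneg fun i _ => mul_self_nonneg _
  simp only [dotProduct_sub, sub_dotProduct] at h0
  simp only [dotProduct_add, add_dotProduct]
  have hc : z ⬝ᵥ r = r ⬝ᵥ z := dotProduct_comm z r
  linarith

/-- **`dotProduct_self_minOp_col_le_of_coercive` — THE MASS OF A MINIMISER COLUMN** [our proof]: `H` PSD, bordered matrix nonsingular, coercivity on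
`ker Q` (`γ|z|² ≤ ⟨z,Hz⟩`, `γ > 0`) and ONE admissible reference field `r` (`Q r = e_a`) ⟹ `|ℋe_a|² ≤ 4(𝒮_{aa} + ⟨r,Hr⟩)∕γ + 2|r|²`
(`ℋe_a = r + z`, `z ∈ ker Q`; `⟨z,Hz⟩ ≤ 2⟨ℋe_a,Hℋe_a⟩ + 2⟨r,Hr⟩ = 2𝒮_{aa} + 2⟨r,Hr⟩`). -/
theorem dotProduct_self_minOp_col_le_of_coercive (hH : H.PosSemidef) (h : IsUnit (kkt H Q).det) {γ : ℝ} (hγ : 0 < γ)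
    (hcoer : ∀ z : ν → ℝ, Q *ᵥ z = 0 → γ * (z ⬝ᵥ z) ≤ z ⬝ᵥ (H *ᵥ z)) {a : c} {r : ν → ℝ} (hr : Q *ᵥ r = Pi.single a 1) :
    (minOp H Q *ᵥ Pi.single a 1) ⬝ᵥ (minOp H Q *ᵥ Pi.single a 1) ≤ 4 * (effForm H Q a a + r ⬝ᵥ (H *ᵥ r)) / γ + 2 * (r ⬝ᵥ r) := by
  set u : ν → ℝ := minOp H Q *ᵥ Pi.single a 1 with hu
  have hQu : Q *ᵥ u = Pi.single a 1 := mulVec_minOp h _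
  have hz : Q *ᵥ (u - r) = 0 := by rw [mulVec_sub, hQu, hr, sub_self]
  have hS : u ⬝ᵥ (H *ᵥ u) = effForm H Q a a := by
    rw [hu, ← dotProduct_effForm_eq_energy h, single_dotProduct_mulVec_single]
  have hzH := (hcoer (u - r) hz).trans (form_sub_le_two_mul_add hH u r)
  have hzz : (u - r) ⬝ᵥ (u - r) ≤ (2 * effForm H Q a a + 2 * (r ⬝ᵥ (H *ᵥ r))) / γ := by
    rw [le_div_iff₀ hγ, mul_comm, ← hS]; exact hzH
  have hsum : u ⬝ᵥ u ≤ 2 * ((u - r) ⬝ᵥ (u - r)) + 2 * (r ⬝ᵥ r) := by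
    have := dotProduct_self_add_le_two_mul (u - r) r
    rwa [sub_add_cancel] at this
  have e4 : 4 * (effForm H Q a a + r ⬝ᵥ (H *ᵥ r)) / γ = 2 * ((2 * effForm H Q a a + 2 * (r ⬝ᵥ (H *ᵥ r))) / γ) := by ring
  rw [e4]
  linarith

/-! ## §2 The `G`-mass of the minimiser columns for a bounded PSD carrier -/

omit [DecidableEq c] [DecidableEq ν] in
/-- the Gram matrix of a PSD carrier is PSD: `0 ≤ MᵀGM`. [folklore] -/
theorem posSemidef_gram (hG : G.PosSemidef) (M : Matrix ν c ℝ) : (Mᵀ * G * M).PosSemidef := by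
  have h := hG.conjTranspose_mul_mul_same M
  rwa [Matrix.conjTranspose_eq_transpose_of_trivial] at h

/-- **`gram_minOp_diag_le_of_coercive` — THE DIAGONAL `G`-MASS** [our proof]: a carrier with `⟨v,Gv⟩ ≤ g|v|²` (`0 ≤ g`), coercivity on `ker Q`, a reference
field `r` with `Q r = e_a`, `⟨r,Hr⟩ ≤ E`, `|r|² ≤ ρ`, and `𝒮_{aa} ≤ B` ⟹ `(ℋᵀGℋ)_{aa} ≤ g·(4(B + E)∕γ + 2ρ)`. -/
theorem gram_minOp_diag_le_of_coercive (hH : H.PosSemidef) (h : IsUnit (kkt H Q).det) {g γ B E ρ : ℝ} (hg0 : 0 ≤ g) (hγ : 0 < γ)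
    (hg : ∀ v : ν → ℝ, v ⬝ᵥ (G *ᵥ v) ≤ g * (v ⬝ᵥ v))
    (hcoer : ∀ z : ν → ℝ, Q *ᵥ z = 0 → γ * (z ⬝ᵥ z) ≤ z ⬝ᵥ (H *ᵥ z)) {a : c} {r : ν → ℝ} (hr : Q *ᵥ r = Pi.single a 1)
    (hE : r ⬝ᵥ (H *ᵥ r) ≤ E) (hρ : r ⬝ᵥ r ≤ ρ) (hB : effForm H Q a a ≤ B) :
    ((minOp H Q)ᵀ * G * minOp H Q) a a ≤ g * (4 * (B + E) / γ + 2 * ρ) := by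
  rw [gram_minOp_apply]
  have h1 := dotProduct_self_minOp_col_le_of_coercive hH h hγ hcoer hr
  have h2 : 4 * (effForm H Q a a + r ⬝ᵥ (H *ᵥ r)) / γ + 2 * (r ⬝ᵥ r) ≤ 4 * (B + E) / γ + 2 * ρ := by
    have : 4 * (effForm H Q a a + r ⬝ᵥ (H *ᵥ r)) / γ ≤ 4 * (B + E) / γ :=
      div_le_div_of_nonneg_right (by linarith) hγ.le
    linarith
  exact (hg _).trans (mul_le_mul_of_nonneg_left (h1.trans h2) hg0)

/-- **`abs_gram_minOp_le_of_coercive` — THE PRODUCED `hN`** [our proof]: `H` PSD, bordered matrix nonsingular, `G` PSD with `⟨v,Gv⟩ ≤ g|v|²` (`0 ≤ g`),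
coercivity `γ|z|² ≤ ⟨z,Hz⟩` on `ker Q` (`γ > 0`), reference fields `r_a` (`Q r_a = e_a`, `⟨r_a,Hr_a⟩ ≤ E`, `|r_a|² ≤ ρ`) and the diagonal size `𝒮_{aa} ≤ B`
⟹ **`|(ℋᵀGℋ)_{ab}| ≤ g·(4(B + E)∕γ + 2ρ)` for all `a, b`** (the Gram matrix is PSD: entries ≤ diagonal). -/
theorem abs_gram_minOp_le_of_coercive (hH : H.PosSemidef) (h : IsUnit (kkt H Q).det) (hG : G.PosSemidef) {g γ B E ρ : ℝ} (hg0 : 0 ≤ g)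
    (hγ : 0 < γ) (hg : ∀ v : ν → ℝ, v ⬝ᵥ (G *ᵥ v) ≤ g * (v ⬝ᵥ v))
    (hcoer : ∀ z : ν → ℝ, Q *ᵥ z = 0 → γ * (z ⬝ᵥ z) ≤ z ⬝ᵥ (H *ᵥ z)) (r : c → ν → ℝ) (hr : ∀ a, Q *ᵥ r a = Pi.single a 1)
    (hE : ∀ a, r a ⬝ᵥ (H *ᵥ r a) ≤ E) (hρ : ∀ a, r a ⬝ᵥ r a ≤ ρ) (hB : ∀ a, effForm H Q a a ≤ B) :
    ∀ a b, |((minOp H Q)ᵀ * G * minOp H Q) a b| ≤ g * (4 * (B + E) / γ + 2 * ρ) :=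
  abs_apply_le_of_diag_le (posSemidef_gram hG (minOp H Q))
    (fun a => gram_minOp_diag_le_of_coercive hH h hg0 hγ hg hcoer (hr a) (hE a) (hρ a) (hB a))

/-- the diagonal size of `𝒮` from an entry bound (for feeding `hB`-shaped data). [folklore] -/
theorem effForm_diag_le_of_abs_le {B : ℝ} (h𝒮 : ∀ a b, |effForm H Q a b| ≤ B) (a : c) : effForm H Q a a ≤ B := (abs_le.mp (h𝒮 a a)).2

end OneLevel

/-! ## §3 Along the tower: the `G`-mass schedule from level letters, and PART 20's END with `hN` discharged -/

section Tower

variable {c : Type*} [Fintype c] [DecidableEq c]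
variable {ι : ℕ → Type*} [∀ j, Fintype (ι j)] [∀ j, DecidableEq (ι j)]
variable {H : ∀ j, Matrix (ι j) (ι j) ℝ} {Qf : ∀ j, Matrix (ι j) (ι (j + 1)) ℝ} {Qc : ∀ j, Matrix c (ι j) ℝ}
variable {P : ∀ j, Matrix (ι (j + 1)) (ι j) ℝ} {G : ∀ j, Matrix (ι j) (ι j) ℝ} {cst cε cδ θ B : ℝ}

/-- **`abs_gram_minOp_schedule_of_coercive` — THE `G`-MASS SCHEDULE FROM LEVEL LETTERS** [our proof]: PSD fine forms, nonsingular bordered matrices, PSD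
carriers with `⟨v,G_jv⟩ ≤ g_j|v|²`, coercivity `γ_j|z|² ≤ ⟨z,H_jz⟩` on `ker Qc_j`, reference fields `r j a` (`Qc_j r_{j,a} = e_a`, energies `≤ E_j`, masses
`≤ ρ_j`), diagonal sizes `𝒮_j(a,a) ≤ B`, and ANY majorant `g_j·(4(B + E_j)∕γ_j + 2ρ_j) ≤ n_j` (PART 20: `n_j = N`; PART 88: `n_j = N₀Λ^j` — the growth `Λ` is the
count of these letters) ⟹ `|(ℋ_jᵀG_jℋ_j)_{ab}| ≤ n_j` for all `j, a, b`. -/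
theorem abs_gram_minOp_schedule_of_coercive (hH : ∀ j, (H j).PosSemidef) (hk : ∀ j, IsUnit (kkt (H j) (Qc j)).det)
    (hGp : ∀ j, (G j).PosSemidef) {g γ E ρ n : ℕ → ℝ} (hg0 : ∀ j, 0 ≤ g j) (hγ : ∀ j, 0 < γ j)
    (hg : ∀ j (v : ι j → ℝ), v ⬝ᵥ (G j *ᵥ v) ≤ g j * (v ⬝ᵥ v))
    (hcoer : ∀ j (z : ι j → ℝ), Qc j *ᵥ z = 0 → γ j * (z ⬝ᵥ z) ≤ z ⬝ᵥ (H j *ᵥ z))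
    (r : ∀ j, c → ι j → ℝ) (hr : ∀ j a, Qc j *ᵥ r j a = Pi.single a 1) (hE : ∀ j a, r j a ⬝ᵥ (H j *ᵥ r j a) ≤ E j)
    (hρ : ∀ j a, r j a ⬝ᵥ r j a ≤ ρ j) (hBd : ∀ j a, effForm (H j) (Qc j) a a ≤ B)
    (hn : ∀ j, g j * (4 * (B + E j) / γ j + 2 * ρ j) ≤ n j) :
    ∀ j a b, |((minOp (H j) (Qc j))ᵀ * G j * minOp (H j) (Qc j)) a b| ≤ n j := fun j a b =>
  (abs_gram_minOp_le_of_coercive (hH j) (hk j) (hGp j) (hg0 j) (hγ j) (hg j) (hcoer j) (r j) (hr j) (hE j) (hρ j) (hBd j) a b).trans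
    (hn j)

/-- **`effForm_entry_step_rate_of_stabGram_of_cons_of_coercive` — PART 20's TOWER END WITH `hN` DISCHARGED** [our proof]: PSD fine forms, nonsingular
bordered matrices, `Qc (j+1) = Qc j·Qf j`, `Qc (j+1)·P j = Qc j`; (STAB-ε_j,δ_j) `(Qf j)ᵀH_j(Qf j) ≤ (1 + cε·θ^j)·H_{j+1} + (cδ·θ^j)·G_{j+1}` with PSD carriers
`⟨v,G_jv⟩ ≤ g|v|²`; (CONS_{j,y}) `≤ cst·θ^j`; the diagonal size `𝒮_j(a,a) ≤ B` (PART 94: `B = B₀ + cst∕(1−θ)` from (CONS)); k-uniform coercivity `γ|z|² ≤ ⟨z,H_jz⟩`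
on `ker Qc_j` and reference fields with energies `≤ E`, masses `≤ ρ` (`0 ≤ cε, cδ, g`, `0 < γ`, `0 ≤ θ`) ⟹
`|𝒮_{j+1}(a,b) − 𝒮_j(a,b)| ≤ (cst + 2cε·B + 2cδ·g(4(B + E)∕γ + 2ρ))·θ^j` for all `j, a, b`. -/
theorem effForm_entry_step_rate_of_stabGram_of_cons_of_coercive (hH : ∀ j, (H j).PosSemidef)
    (hk : ∀ j, IsUnit (kkt (H j) (Qc j)).det) (hcomp : ∀ j, Qc (j + 1) = Qc j * Qf j) (hPQ : ∀ j, Qc (j + 1) * P j = Qc j)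
    (hGp : ∀ j, (G j).PosSemidef) {g γ E ρ : ℝ} (hcε : 0 ≤ cε) (hcδ : 0 ≤ cδ) (hθ0 : 0 ≤ θ) (hg0 : 0 ≤ g) (hγ : 0 < γ)
    (hstab : ∀ j, ((1 + cε * θ ^ j) • H (j + 1) + (cδ * θ ^ j) • G (j + 1) - (Qf j)ᵀ * H j * Qf j).PosSemidef)
    (hcons : ∀ j (y : c), (minOp (H j) (Qc j) *ᵥ Pi.single y 1) ⬝ᵥ
        (((P j)ᵀ * H (j + 1) * P j - H j) *ᵥ (minOp (H j) (Qc j) *ᵥ Pi.single y 1)) ≤ cst * θ ^ j)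
    (hBd : ∀ j a, effForm (H j) (Qc j) a a ≤ B)
    (hg : ∀ j (v : ι j → ℝ), v ⬝ᵥ (G j *ᵥ v) ≤ g * (v ⬝ᵥ v))
    (hcoer : ∀ j (z : ι j → ℝ), Qc j *ᵥ z = 0 → γ * (z ⬝ᵥ z) ≤ z ⬝ᵥ (H j *ᵥ z))
    (r : ∀ j, c → ι j → ℝ) (hr : ∀ j a, Qc j *ᵥ r j a = Pi.single a 1) (hE : ∀ j a, r j a ⬝ᵥ (H j *ᵥ r j a) ≤ E)
    (hρ : ∀ j a, r j a ⬝ᵥ r j a ≤ ρ) :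
    ∀ j (a b : c), |effForm (H (j + 1)) (Qc (j + 1)) a b - effForm (H j) (Qc j) a b| ≤
      (cst + 2 * cε * B + 2 * cδ * (g * (4 * (B + E) / γ + 2 * ρ))) * θ ^ j :=
  effForm_entry_step_rate_of_stabGram_of_cons hH hk hcomp hPQ (fun j => transpose_eq_of_posSemidef (hGp j)) hcε hcδ hθ0 hstab hcons
    (fun j a b => abs_apply_le_of_diag_le (posSemidef_effForm (hH j) (hk j)) (hBd j) a b)
    (abs_gram_minOp_schedule_of_coercive hH hk hGp (fun _ => hg0) (fun _ => hγ) hg hcoer r hr hE hρ hBd (fun _ => le_rfl))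

end Tower

end Summit.QuantumFields.BalabanUV.Beta.GAN24.DerivativeRateTransferLoewnerGramMass

end
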